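import Summits.BirchSwinnertonDyer.BirchSwinnertonDyer.Theorems.GenusKolyvaginAtTwoK4NegDerivativeIsGenus
import HarnessLib

/-!
# Route `GenusKolyvaginAtTwo`, crux K₄⁻ `K4Neg` (stmt-BirchSwinnertonDyer-31526) — AT p = 2 KOLYVAGIN'S DERIVATIVE AT A SQUARE-FREE LEVEL IS A
# NESTED GENUS NORM: `D_n y ≡ σ₁N₂⁽¹⁾ σ₂N₂⁽²⁾ ⋯ σ_rN₂⁽ʳ⁾ y (mod 2)`, hence `P(n) ∈ 2E(K[n]) ⟺` the nested genus norm is `2`-divisible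

Seat `bsd-line-gk2-p3` g35 (PROVER seat 3/3, cell `bsd-f1-sign2`), `--supports stmt-BirchSwinnertonDyer-31526 --as helper`.  THEOREMS ONLY
(no definition, no named fact, no `sorry`); standard axioms.  **BSD is NOT proved by this file; K4Neg is NOT proved (nor refuted); nothing is closed.**

WHY.  The LEAD's G1/G1′ (`…K4NegDerivativeIsGenus`, gk2-p1 g25: `D_ℓ = 2·D′ + σ·N₂`, so at a PRIME level `P(ℓ) ∈ 2E(K[ℓ])` iff the `σ`-translate of the
`S`-trace of the index-two norm `N₂ y(ℓ)` is) is the `r = 1` case of the genus reading of K4Neg's witnesses.  K4Neg asks for a SQUARE-FREE `n`;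
LEAD-BRIEF-g29 §3 leaves the composite levels on the (β)/𝒫-frames undecided («if ever `Γ_m` is visible … K4Neg holds»).  This seat's memo
(`K4NEG-BETA-GENUS-VERDICT-gk2p3-g35.md`) reads `P(n) mod 2` for EVERY square-free `n` as the multi-genus Heegner vector; this file is the exact
(not congruence) operator identity behind that reading, for the tree's `KolyvaginOperator.derivOpProd` / `KolyvaginHeegnerData.derivedPoint`.

WHAT (monoid action `ρ : G →* End(A)`, no commutativity, no `σ^{ℓ+1} = 1`).
* §1 `derivOp_add`, `derivOp_nsmul` — `D_ℓ` is additive; ★ `exists_derivOpProd_eq_two_nsmul_add_foldr` — for a list `L` of ODD levels,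
  **`D_L y = 2·T + 𝒩_L y`** with the NESTED NORM `𝒩_L y = foldr (ℓ ↦ σ_ℓ · Σ_{j<(ℓ+1)/2} σ_ℓ^{2j}) y L` (written with `List.foldr`, no new
  definition): induction on `L` with G1 at each step.
* §2 ★★ `two_dvd_derivedPoint_iff_of_odd` — for the tree's `KolyvaginHeegnerData` at ANY level `n` all of whose prime factors are odd (e.g. `n` odd
  square-free, as in K4Neg: Kolyvagin primes are odd): **`(∃ Q, 2•Q = P(n)) ↔ (∃ Q, 2•Q = Σ_{s∈S} s (𝒩_{n.primeFactorsList} y(n)))`**.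
ARITHMETIC READING (prose, NOT proved here): in the abelian group `Gal(K[n]/K[1]) = ∏ G_ℓ` the inner sums are the norms of the index-`2` subgroups
`H_ℓ = ⟨σ_ℓ²⟩`, so `𝒩 y(n) = (∏σ_ℓ)·Tr_{K[n]/K[1]F_n} y(n)` with `F_n = K(√−ℓ₁,…,√−ℓ_r)` the multi-genus field (`4 ∣ ℓ_i + 1`), and after the `S`-trace
(odd `h_K`) `P(n) ≡ ±g·Tr_{K[n]/F_n} y(n) (mod 2E(K[n]))`: K4Neg at level `n` is a `2^{r+1}`-divisibility statement about ONE `χ_n`-twisted Heegner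
vector (memo §2).  BSD is NOT proved by any of this.

References: [GrossLMS1991] §3 (3.5), §4 (4.1); [WZhang2014] §3.7.
-/

set_option autoImplicit false
-- the Theorems namespace of this sub repeats the summit name by design (D-0017 nested layout)
set_option linter.dupNamespace false

namespace Summit.BirchSwinnertonDyer.BirchSwinnertonDyer.Theorems.GenusSupplyNarrow.KFourCell.DerivativeIsGenus

open Finset Literature.NumberTheory.EllipticCurves

/-! ## §1 `D_L = 2·T + 𝒩_L` along a list of odd levels -/

section Abstract

variable {G : Type*} [Monoid G] {A : Type*} [AddCommMonoid A] (ρ : G →* AddMonoid.End A)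

/-- `D_ℓ (a + b) = D_ℓ a + D_ℓ b`. [cite: GrossLMS1991, §3 (3.5)] -/
theorem derivOp_add (σ : G) (ℓ : ℕ) (a b : A) :
    KolyvaginOperator.derivOp ρ σ ℓ (a + b) = KolyvaginOperator.derivOp ρ σ ℓ a + KolyvaginOperator.derivOp ρ σ ℓ b := by
  unfold KolyvaginOperator.derivOp
  rw [← sum_add_distrib]
  exact sum_congr rfl fun i _ ↦ by rw [map_add, nsmul_add]

/-- `D_ℓ (m • a) = m • D_ℓ a`. [cite: GrossLMS1991, §3 (3.5)] -/
theorem derivOp_nsmul (σ : G) (ℓ m : ℕ) (a : A) :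
    KolyvaginOperator.derivOp ρ σ ℓ (m • a) = m • KolyvaginOperator.derivOp ρ σ ℓ a := by
  unfold KolyvaginOperator.derivOp
  rw [Finset.smul_sum]
  exact sum_congr rfl fun i _ ↦ by rw [map_nsmul, smul_comm]

/-- ★ **`D_L y = 2·T + 𝒩_L y` for a list of ODD levels** — Kolyvagin's derivative along `L` (the tree's `derivOpProd`, `D_{ℓ::L} = D_ℓ ∘ D_L`)
is twice something plus the NESTED GENUS NORM `𝒩_L y = foldr (fun ℓ acc ↦ σ_ℓ (Σ_{j<(ℓ+1)/2} σ_ℓ^{2j} acc)) y L`: G1 (`derivOp_eq_two_nsmul_add`)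
at each prime, additivity of `D_ℓ`.  Monoid action; no commutativity or torsion relation is used. [cite: GrossLMS1991, §3 (3.5)] [cite: WZhang2014, §3.7] -/
theorem exists_derivOpProd_eq_two_nsmul_add_foldr (σ : ℕ → G) (L : List ℕ) (hL : ∀ ℓ ∈ L, Odd ℓ) (y : A) :
    ∃ T : A, KolyvaginOperator.derivOpProd ρ σ L y =
      2 • T + L.foldr (fun ℓ acc ↦ ρ (σ ℓ) (∑ j ∈ range ((ℓ + 1) / 2), ρ (σ ℓ ^ (2 * j)) acc)) y := by
  induction L with
  | nil => exact ⟨0, by simp⟩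
  | cons ℓ L ih =>
    obtain ⟨T, hT⟩ := ih fun ℓ' hℓ' ↦ hL ℓ' (List.mem_cons_of_mem ℓ hℓ')
    have hℓ : Odd ℓ := hL ℓ List.mem_cons_self
    have hk : ℓ + 1 = 2 * ((ℓ + 1) / 2) := by
      obtain ⟨m, rfl⟩ := hℓ
      omega
    set F := L.foldr (fun ℓ acc ↦ ρ (σ ℓ) (∑ j ∈ range ((ℓ + 1) / 2), ρ (σ ℓ ^ (2 * j)) acc)) y with hF
    refine ⟨KolyvaginOperator.derivOp ρ (σ ℓ) ℓ T +
      ∑ j ∈ range ((ℓ + 1) / 2), j • (ρ (σ ℓ ^ (2 * j)) F + ρ (σ ℓ ^ (2 * j + 1)) F), ?_⟩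
    rw [KolyvaginOperator.derivOpProd_cons, hT, derivOp_add, derivOp_nsmul, derivOp_eq_two_nsmul_add ρ (σ ℓ) F hk,
      List.foldr_cons, nsmul_add, add_assoc]

end Abstract

/-! ## §2 ★★ The tree's derived Heegner point at an odd level -/

section OddLevel

variable {A : Type*} [AddCommGroup A]

variable {N : ℕ} [NeZero N] {W : WeierstrassCurve ℚ} {K : Type} [Field K] [NumberField K]
  {Dt : ModularForms.ModularParametrizationData W N} {β : ℤ} {ι : K →+* ℂ}

/-- **`P(n) = 2·(Σ_s s T) + Σ_s s (𝒩_n y(n))`** — the derived point of the tree's `KolyvaginHeegnerData` at a level `n` with only ODD prime factors,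
split along §1 (`𝒩_n` = the nested genus norm along `n.primeFactorsList`). BSD is NOT proved by this. [cite: GrossLMS1991, §4 (4.1)] -/
theorem exists_derivedPoint_eq_two_nsmul_add_of_odd {n : ℕ} (hn : ∀ ℓ ∈ n.primeFactorsList, Odd ℓ) (d : KolyvaginHeegnerData Dt β ι n) :
    ∃ T : (W.baseChange (ringClassField K ι n)).toAffine.Point,
      d.derivedPoint = 2 • T +
        ∑ s ∈ d.S, pointGalHom W (ringClassField K ι n) s
          (n.primeFactorsList.foldr (fun ℓ acc ↦ pointGalHom W (ringClassField K ι n) (d.σ ℓ)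
            (∑ j ∈ range ((ℓ + 1) / 2), pointGalHom W (ringClassField K ι n) (d.σ ℓ ^ (2 * j)) acc)) d.y) := by
  obtain ⟨T, hT⟩ := exists_derivOpProd_eq_two_nsmul_add_foldr (pointGalHom W (ringClassField K ι n)) d.σ n.primeFactorsList hn d.y
  refine ⟨∑ s ∈ d.S, pointGalHom W (ringClassField K ι n) s T, ?_⟩
  unfold KolyvaginHeegnerData.derivedPoint KolyvaginOperator.derivedPoint
  rw [hT]
  simp only [map_add, map_nsmul, sum_add_distrib, Finset.smul_sum]

/-- ★★ **At `p = 2`, Kolyvagin's derived point at an ODD level is `2`-divisible iff the `S`-trace of the NESTED GENUS NORM is** — for the tree's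
`KolyvaginHeegnerData.derivedPoint P(n) = Σ_{s∈S} s(D_n y(n))`, `n` with only odd prime factors (every Kolyvagin prime is odd; K4Neg's `n` is an
odd square-free product of deep primes with `4 ∣ ℓ + 1`).  The LEAD's `two_dvd_derivedPoint_prime_iff` is the case `n = ℓ`.  (Arithmetic reading —
prose: the nested norm is `(∏σ_ℓ)`-conjugate to the trace to the multi-genus field `K[1](√−ℓ₁,…,√−ℓ_r)`; after the `S`-trace `P(n) mod 2E(K[n])`
is the multi-genus Heegner point.)  BSD is NOT proved by this; K4Neg is NOT proved by this. [cite: GrossLMS1991, §4 (4.1)] [cite: WZhang2014, §3.7] -/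
theorem two_dvd_derivedPoint_iff_of_odd {n : ℕ} (hn : ∀ ℓ ∈ n.primeFactorsList, Odd ℓ) (d : KolyvaginHeegnerData Dt β ι n) :
    (∃ Q, (2 : ℤ) • Q = d.derivedPoint) ↔
      ∃ Q, (2 : ℤ) • Q =
        ∑ s ∈ d.S, pointGalHom W (ringClassField K ι n) s
          (n.primeFactorsList.foldr (fun ℓ acc ↦ pointGalHom W (ringClassField K ι n) (d.σ ℓ)
            (∑ j ∈ range ((ℓ + 1) / 2), pointGalHom W (ringClassField K ι n) (d.σ ℓ ^ (2 * j)) acc)) d.y) := by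
  obtain ⟨T, hT⟩ := exists_derivedPoint_eq_two_nsmul_add_of_odd hn d
  rw [hT]
  exact exists_two_zsmul_eq_add_iff _ _

/-- **Odd square-free `n` ⟹ every prime factor of `n` is odd** (the shape of the hypothesis above from K4Neg's data: `n` square-free with all
`ℓ ∣ n` Kolyvagin primes, which are odd). [folklore] -/
theorem forall_mem_primeFactorsList_odd_of_odd {n : ℕ} (hn : Odd n) : ∀ ℓ ∈ n.primeFactorsList, Odd ℓ := by
  intro ℓ hℓ
  have hℓn : ℓ ∣ n := Nat.dvd_of_mem_primeFactorsList hℓ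
  exact hn.of_dvd_nat hℓn

end OddLevel

end Summit.BirchSwinnertonDyer.BirchSwinnertonDyer.Theorems.GenusSupplyNarrow.KFourCell.DerivativeIsGenus
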